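import Summits.QuantumAdvantage.QuantumAdvantage.Theses.SosSandwich
import Literature.Computability.QuantumComplexity.PseudoBounded

/-!
# Route `SosSandwich`, support `PseudoBoundedDual` (stmt-QuantumAdvantage-15244) — the easy direction

If `p` is pseudo-bounded of order `T` then every linear functional `Ẽ` on real functions of the cube with
`Ẽ[1] = 1` and `Ẽ[q²] ≥ 0` for all `q` of total degree `≤ T` satisfies `0 ≤ Ẽ[p] ≤ 1` (apply `Ẽ` to the
two SOS certificates). The converse (closedness of the finite-dimensional SOS cone + separation) is the
content of the item and is NOT proved here; this file is a helper (`--supports`).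
-/

set_option linter.dupNamespace false -- D-0017: single-problem summit ⇒ `QuantumAdvantage.QuantumAdvantage` by design

namespace Summit.QuantumAdvantage.QuantumAdvantage.Theorems.SosSandwich

open Finset MvPolynomial Literature.Computability.QuantumComplexity

/-- **`PseudoBoundedDual`, forward direction**: a degree-`T` SOS sandwich certificate for `p` forces
`0 ≤ Ẽ[p] ≤ 1` for every normalised linear functional that is nonnegative on squares of degree-`≤ T`
polynomials (a degree-`2T` pseudo-expectation). [cite: KaniewskiLeeDewolf2015, Def. 7] -/
theorem pseudoBoundedDual_forward {N : ℕ} (T : ℕ) (p : MvPolynomial (Fin N) ℝ)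
    (hp : PseudoBounded T p) (E : ((Fin N → Bool) → ℝ) →ₗ[ℝ] ℝ) (hE1 : E (fun _ => 1) = 1)
    (hEsq : ∀ q : MvPolynomial (Fin N) ℝ, q.totalDegree ≤ T →
      0 ≤ E (fun x => MvPolynomial.eval (fun k => if x k then (1 : ℝ) else 0) q ^ 2)) :
    0 ≤ E (fun x => MvPolynomial.eval (fun k => if x k then (1 : ℝ) else 0) p) ∧
      E (fun x => MvPolynomial.eval (fun k => if x k then (1 : ℝ) else 0) p) ≤ 1 := by
  obtain ⟨m, q, r, hdeg, hval⟩ := hp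
  have hpf : (fun x => MvPolynomial.eval (fun k => if x k then (1 : ℝ) else 0) p) =
      ∑ j, (fun x : Fin N → Bool => MvPolynomial.eval (fun k => if x k then (1 : ℝ) else 0) (q j) ^ 2) := by
    funext x; rw [Finset.sum_apply]; exact (hval x).1
  have h1pf : (fun x => (1 : ℝ) - MvPolynomial.eval (fun k => if x k then (1 : ℝ) else 0) p) =
      ∑ j, (fun x : Fin N → Bool => MvPolynomial.eval (fun k => if x k then (1 : ℝ) else 0) (r j) ^ 2) := by
    funext x; rw [Finset.sum_apply]; exact (hval x).2
  have hEp : 0 ≤ E (fun x => MvPolynomial.eval (fun k => if x k then (1 : ℝ) else 0) p) := by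
    rw [hpf, map_sum]
    exact Finset.sum_nonneg fun j _ => hEsq (q j) (hdeg j).1
  have hE1p : 0 ≤ E (fun x => (1 : ℝ) - MvPolynomial.eval (fun k => if x k then (1 : ℝ) else 0) p) := by
    rw [h1pf, map_sum]
    exact Finset.sum_nonneg fun j _ => hEsq (r j) (hdeg j).2
  have hsub : E (fun x => (1 : ℝ) - MvPolynomial.eval (fun k => if x k then (1 : ℝ) else 0) p) =
      E (fun _ => (1 : ℝ)) - E (fun x => MvPolynomial.eval (fun k => if x k then (1 : ℝ) else 0) p) := by
    rw [← map_sub]; rfl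
  refine ⟨hEp, ?_⟩
  rw [hsub, hE1] at hE1p
  linarith

/-- The forward half of route item `PseudoBoundedDual` in the item's literal shape (inline `ev`):
`(K_T certificate) → ∀ Ẽ normalised and square-positive up to degree T, 0 ≤ Ẽ[p] ≤ 1`.
[cite: KaniewskiLeeDewolf2015, Def. 7] -/
theorem pseudoBoundedDual_mp (N T : ℕ) (p : MvPolynomial (Fin N) ℝ) :
    let ev : MvPolynomial (Fin N) ℝ → (Fin N → Bool) → ℝ :=
      fun f x => MvPolynomial.eval (fun k => if x k then (1 : ℝ) else 0) f
    (∃ (m : ℕ) (q r : Fin m → MvPolynomial (Fin N) ℝ),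
      (∀ j, (q j).totalDegree ≤ T ∧ (r j).totalDegree ≤ T) ∧
      ∀ x : Fin N → Bool, ev p x = ∑ j, ev (q j) x ^ 2 ∧ 1 - ev p x = ∑ j, ev (r j) x ^ 2) →
    ∀ E : ((Fin N → Bool) → ℝ) →ₗ[ℝ] ℝ, E (fun _ => 1) = 1 →
      (∀ q : MvPolynomial (Fin N) ℝ, q.totalDegree ≤ T → 0 ≤ E (fun x => ev q x ^ 2)) →
      0 ≤ E (ev p) ∧ E (ev p) ≤ 1 := by
  intro ev hK E hE1 hEsq
  exact pseudoBoundedDual_forward T p hK E hE1 hEsq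

end Summit.QuantumAdvantage.QuantumAdvantage.Theorems.SosSandwich
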